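import Summits.Ventures.CertifiedManyBodySolver.Observables.StiffnessApexTransportLaBoxE
import HarnessLib

/-!
# Ventures/CertifiedManyBodySolver — Observables/StiffnessApexTransportLaBoxEControls.lean

HONEST FRAMING: one-sided certified CEILINGS on the uniform flux stiffness (t–t′ f-sum class) at half filling, TRANSPORTED from ONE corner
row to literal CONTROL points / columns of the «La214-E» box by the apex rule; every statement is CONDITIONAL on the corner row it takes as a
hypothesis (row-of-record shape, numbers FREE); a ceiling never speaks to the presence of order; CONTROL/CALIBRATION class; not a `T_c`
estimate, not a superconductivity verdict; no phase sentence. Zero compute, no definition, no claim node, no `sorry`.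

Cell `pub/hubbard-downfold` (D-0150 L-DF2), seat `hubbard-downfold-unc-2` (`prover-hubbard-downfold-unc-2-g14-0`); the «one `exact` each» CONTROL
instances of APEX-RECIPE §1 written out with LITERAL target coordinates, so that the hour a corner stiffness node lands (hubbard-obs p2 g17:
kit j295893 = first-pass f-sum stiffness at the CALIBRATION corner `(6, 1, −3/10)`; the station-`29/5` corner words on the A-laws) the pen's
CONTROL rows are the node reader composed with ONE of the theorems below — no arithmetic left to do:

* §1 corner `(6, 1, −3/10)` (row `SquareTTPrimeCorrOrbitLowerRow (−3/10) 6 1 u r univ Λ₇ (−X₀(−3/10))` + cap `u`): the word `c ≥ −r` holds at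
  the apex-curve points `(8, 1, −6/25)`, `(9, 1, −9/40)`, `(12, 1, −1/5)` (the last ON the La214-E inner edge), on the whole curve
  `(U, −(3/10)U/(2U − 6))`, `U > 6`, and on the REGION columns `t′ ∈ [−6/25, −1/5]` at `U = 8`, `t′ ∈ [−9/40, −1/5]` at `U = 9` (clipped to the box;
  the region's line side `t′ = −(3/10)(12 − U)/6` leaves the box above `t′ = −1/5`);
* §2 corner `(29/5, 1, −3/10)`: points `(8, 1, −4/17)`, `(10, 1, −15/71)`, `(58/5, 1, −1/5)`; columns `t′ ∈ [−4/17, −27/145]` at `U = 8`,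
  `t′ ∈ [−15/71, −1/5]` at `U = 10` (box-clipped; the full region column is `[−15/71, −12/145]`);
* §3 corner `(29/5, 1, −1/5)` (inner corner): points `(29/4, 1, −1/6)`… lie OUTSIDE the box (`|t′| < 1/5`): recorded as the curve only.

References: T. Koma, H. Tasaki, J. Stat. Phys. 76 (1994) 745, §1 [KomaTasaki1994]; D. J. Scalapino, S. R. White, S.-C. Zhang, PRB 47 (1993)
7995, §II [ScalapinoWhiteZhang1993].
-/

noncomputable section

namespace Summit.Ventures.CertifiedManyBodySolver.Observables

open Literature.MathematicalPhysics.QuantumLattice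
open Literature.MathematicalPhysics.QuantumLattice.ThermodynamicLimit
open Literature.MathematicalPhysics.QuantumFieldTheory
open Literature.Probability.LatticeModels
open Matrix Finset Filter Topology HubbardWave0
open scoped Matrix BigOperators ComplexOrder

/-! ## §1 The CALIBRATION corner `(6, 1, −3/10)` (kit j295893's word, when it prints) -/

section Corner6

variable {u r : ℚ}

/-- **Corner `(6, 1, −3/10)` ⇒ its whole apex curve**: `ObsStiffnessSeqCeilingAt (−(3/10)·U/(2U − 6)) U 1 c` for every `U > 6`, `c ≥ −r`.
[cite: KomaTasaki1994, §1] [cite: ScalapinoWhiteZhang1993, §II] -/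
theorem laBoxE_corner6_apexCurve_of_fsumRow (Uo : ℝ)
    (hrow : SquareTTPrimeCorrOrbitLowerRow (-3 / 10) 6 1 u r Finset.univ (box 2 7) (-oddMomentObsTT (-3 / 10) Uo 0))
    (hu : energyDensityTT' 1 (-3 / 10) 6 1 ≤ ((u : ℚ) : ℝ)) (c : ℚ) (hc : -r ≤ c) {U : ℝ} (hU : 6 < U) :
    ObsStiffnessSeqCeilingAt (-3 / 10 * U / (2 * U - 6)) U 1 c :=
  ObsStiffnessSeqCeilingAt_halfFilling_on_apexCurve_of_fsumRow Uo (by norm_num) hrow hu c hc hU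

/-- **Corner `(6, 1, −3/10)` ⇒ the three literal CONTROL points** `(8, 1, −6/25)`, `(9, 1, −9/40)`, `(12, 1, −1/5)` (the last on the La214-E
inner edge `t′ = −1/5`). [cite: KomaTasaki1994, §1] [cite: ScalapinoWhiteZhang1993, §II] -/
theorem laBoxE_corner6_apexCurve_controls (Uo : ℝ)
    (hrow : SquareTTPrimeCorrOrbitLowerRow (-3 / 10) 6 1 u r Finset.univ (box 2 7) (-oddMomentObsTT (-3 / 10) Uo 0))
    (hu : energyDensityTT' 1 (-3 / 10) 6 1 ≤ ((u : ℚ) : ℝ)) (c : ℚ) (hc : -r ≤ c) :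
    ObsStiffnessSeqCeilingAt (-6 / 25) 8 1 c ∧ ObsStiffnessSeqCeilingAt (-9 / 40) 9 1 c ∧ ObsStiffnessSeqCeilingAt (-1 / 5) 12 1 c := by
  obtain ⟨e8, e9, e12⟩ := laBoxE_corner6_apexCurve_points
  refine ⟨?_, ?_, ?_⟩
  · have h := laBoxE_corner6_apexCurve_of_fsumRow Uo hrow hu c hc (U := 8) (by norm_num)
    rwa [e8] at h
  · have h := laBoxE_corner6_apexCurve_of_fsumRow Uo hrow hu c hc (U := 9) (by norm_num)
    rwa [e9] at h
  · have h := laBoxE_corner6_apexCurve_of_fsumRow Uo hrow hu c hc (U := 12) (by norm_num)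
    rwa [e12] at h

/-- **Corner `(6, 1, −3/10)` ⇒ the REGION columns inside the La214-E box**: `t′ ∈ [−6/25, −1/5]` at `U = 8` and `t′ ∈ [−9/40, −1/5]` at `U = 9`
(`ObsStiffnessSeqCeilingAt_halfFilling_on_apexRegion_of_fsumRow`: `6·t′ ≤ (−3/10)(12 − U)` and `(−3/10)·U ≤ t′(2U − 6)`).
[cite: KomaTasaki1994, §1] [cite: ScalapinoWhiteZhang1993, §II] -/
theorem laBoxE_corner6_apexRegion_columns (Uo : ℝ)
    (hrow : SquareTTPrimeCorrOrbitLowerRow (-3 / 10) 6 1 u r Finset.univ (box 2 7) (-oddMomentObsTT (-3 / 10) Uo 0))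
    (hu : energyDensityTT' 1 (-3 / 10) 6 1 ≤ ((u : ℚ) : ℝ)) (c : ℚ) (hc : -r ≤ c) :
    (∀ tp ∈ Set.Icc (-6 / 25 : ℝ) (-1 / 5), ObsStiffnessSeqCeilingAt tp 8 1 c) ∧
      (∀ tp ∈ Set.Icc (-9 / 40 : ℝ) (-1 / 5), ObsStiffnessSeqCeilingAt tp 9 1 c) := by
  refine ⟨fun tp htp => ?_, fun tp htp => ?_⟩
  · exact ObsStiffnessSeqCeilingAt_halfFilling_on_apexRegion_of_fsumRow Uo (by norm_num) hrow hu c hc (by norm_num)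
      (by linarith [htp.2]) (by linarith [htp.2]) (by linarith [htp.1])
  · exact ObsStiffnessSeqCeilingAt_halfFilling_on_apexRegion_of_fsumRow Uo (by norm_num) hrow hu c hc (by norm_num)
      (by linarith [htp.2]) (by linarith [htp.2]) (by linarith [htp.1])

end Corner6

/-! ## §2 The station corner `(29/5, 1, −3/10)` (its word on the `A₂`/`A₁` law, when it prints) -/

section Corner29o5

variable {u r : ℚ}

/-- **Corner `(29/5, 1, −3/10)` ⇒ its whole apex curve** `(U, −(3/10)U/(2U − 29/5))`, `U > 29/5`. [cite: KomaTasaki1994, §1] [cite: ScalapinoWhiteZhang1993, §II] -/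
theorem laBoxE_corner29o5_apexCurve_of_fsumRow (Uo : ℝ)
    (hrow : SquareTTPrimeCorrOrbitLowerRow (-3 / 10) (29 / 5) 1 u r Finset.univ (box 2 7) (-oddMomentObsTT (-3 / 10) Uo 0))
    (hu : energyDensityTT' 1 (-3 / 10) (29 / 5) 1 ≤ ((u : ℚ) : ℝ)) (c : ℚ) (hc : -r ≤ c) {U : ℝ} (hU : 29 / 5 < U) :
    ObsStiffnessSeqCeilingAt (-3 / 10 * U / (2 * U - 29 / 5)) U 1 c :=
  ObsStiffnessSeqCeilingAt_halfFilling_on_apexCurve_of_fsumRow Uo (by norm_num) hrow hu c hc hU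

/-- **Corner `(29/5, 1, −3/10)` ⇒ the three literal CONTROL points** `(8, 1, −4/17)`, `(10, 1, −15/71)`, `(58/5, 1, −1/5)` (the last on the inner
edge). [cite: KomaTasaki1994, §1] [cite: ScalapinoWhiteZhang1993, §II] -/
theorem laBoxE_corner29o5_apexCurve_controls (Uo : ℝ)
    (hrow : SquareTTPrimeCorrOrbitLowerRow (-3 / 10) (29 / 5) 1 u r Finset.univ (box 2 7) (-oddMomentObsTT (-3 / 10) Uo 0))
    (hu : energyDensityTT' 1 (-3 / 10) (29 / 5) 1 ≤ ((u : ℚ) : ℝ)) (c : ℚ) (hc : -r ≤ c) :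
    ObsStiffnessSeqCeilingAt (-4 / 17) 8 1 c ∧ ObsStiffnessSeqCeilingAt (-15 / 71) 10 1 c ∧
      ObsStiffnessSeqCeilingAt (-1 / 5) (58 / 5) 1 c := by
  obtain ⟨e8, e10, e58⟩ := laBoxE_corner29o5_apexCurve_points
  refine ⟨?_, ?_, ?_⟩
  · have h := laBoxE_corner29o5_apexCurve_of_fsumRow Uo hrow hu c hc (U := 8) (by norm_num)
    rwa [e8] at h
  · have h := laBoxE_corner29o5_apexCurve_of_fsumRow Uo hrow hu c hc (U := 10) (by norm_num)
    rwa [e10] at h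
  · have h := laBoxE_corner29o5_apexCurve_of_fsumRow Uo hrow hu c hc (U := 58 / 5) (by norm_num)
    rwa [e58] at h

/-- **Corner `(29/5, 1, −3/10)` ⇒ the REGION columns inside the La214-E box**: `t′ ∈ [−4/17, −27/145]` at `U = 8` and `t′ ∈ [−15/71, −1/5]` at
`U = 10` (the full region column at `U = 10` is `[−15/71, −12/145]`; clipped to the box edge `−1/5`). [cite: KomaTasaki1994, §1] [cite: ScalapinoWhiteZhang1993, §II] -/
theorem laBoxE_corner29o5_apexRegion_columns (Uo : ℝ)
    (hrow : SquareTTPrimeCorrOrbitLowerRow (-3 / 10) (29 / 5) 1 u r Finset.univ (box 2 7) (-oddMomentObsTT (-3 / 10) Uo 0))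
    (hu : energyDensityTT' 1 (-3 / 10) (29 / 5) 1 ≤ ((u : ℚ) : ℝ)) (c : ℚ) (hc : -r ≤ c) :
    (∀ tp ∈ Set.Icc (-4 / 17 : ℝ) (-27 / 145), ObsStiffnessSeqCeilingAt tp 8 1 c) ∧
      (∀ tp ∈ Set.Icc (-15 / 71 : ℝ) (-1 / 5), ObsStiffnessSeqCeilingAt tp 10 1 c) := by
  refine ⟨fun tp htp => ?_, fun tp htp => ?_⟩
  · exact ObsStiffnessSeqCeilingAt_halfFilling_on_apexRegion_of_fsumRow Uo (by norm_num) hrow hu c hc (by norm_num)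
      (by linarith [htp.2]) (by linarith [htp.2]) (by linarith [htp.1])
  · exact ObsStiffnessSeqCeilingAt_halfFilling_on_apexRegion_of_fsumRow Uo (by norm_num) hrow hu c hc (by norm_num)
      (by linarith [htp.2]) (by linarith [htp.2]) (by linarith [htp.1])

end Corner29o5

end Summit.Ventures.CertifiedManyBodySolver.Observables

end
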